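import Summits.QuantumFields.BalabanUV.Beta.D1BFx.NeedleGhostTadpoleRow

/-!
# `BalabanUV.Beta.D1BFx.NeedleGhostTadpoleRowMass` — road «BF-x» for binder row D1, slot (K), END row `hGrp gN`, (N-2) «NT-7» SECOND FORM:
# **THE COMPLETED GHOST TADPOLE ROW `h₇` UNDER THE LEG's BLOCK-ROW |·|-MASS LETTER AT BLOCK DISTANCE 0** — the count of `NeedleGhostTadpoleRow` (p256709)
# with the leg's sup `GhostLeg.bdd_Ggh` replaced by a DISPLAYED letter `hM0 : Σ_{z ∈ B(Y)} |Ggh n a x z| ≤ cM` (n-free `cM`; the distance-0 instance of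
# an3-g56's located letter M10 — NOT minted, a hypothesis to be instantiated from print like the END's `h12`, owner ruling ρ-g9-28 (f)) and the needle
# INDICATOR of the second stripped jet: `|T₇(b+w,b)| ≤ 2·|x₀cQ|·cM`, hence `h₇` under `|ωgh n·x₀ n·cQ n| ≤ k·n²` — TOLERANCE `n²` (first form: `n⁻²`)

HONEST DEPENDENCY (cell records, verbatim): «continuum YM on T⁴ ⇐ BetaPertH ∧ nine spine estimates (0/9 proved); BetaPertH ⇐ (D1) ∧ (D4) ∧
CAP+tail; G-an2-4 gates asym, D1 and NE2/3/4.»  HONEST FRAMING (cell contract, verbatim): «discharging `BetaPertH` makes Bałaban's UV stability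
UNCONDITIONAL — a real constructive-QFT result; it is NOT the continuum limit and NOT the Clay problem.»  THIS MODULE DISCHARGES NOTHING of the wall:
it is [folklore] finite bookkeeping BY NAME over `NeedleGhostTadpoleRow` (`tadpole_eq_sum_of_support`, `WghAt_offDiag`, `T₇_eq_zero_of_far`,
`qSqAt_eq_zero_of_not_mem_left∕right`), `GhostNeedleRootedLetters` (`abs_qAntiAt_le`, `qJetAt_le_indicator`), `AveragingJetNeedle.card_needle_le`, `GhostLeg.Ggh_symm`,
leaf A6 `ContactCount` and the owner's `Assembly`.  The leg letter `hM0` and the scaling letter are DISPLAYED hypotheses, ruled nowhere here; the weights are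
ARBITRARY sequences; nothing about Bałaban's operators is asserted.  No `def`, no `def … : Prop`, nothing cited, 0 sorry.  Root-level binders hW ∕ hR-sockets ∕
hSX-socket ∕ D1Tel ∕ D1Rep — 0 discharged; (K) NOT closed; NOT D1, NOT `BetaPertH`, NOT continuum, NOT Clay.

ABSOLUTE RULE (cell charter, verbatim): «No internally-minted statement may enter as a cited fact. Every hypothesis is either kernel-proved in this
package or a verbatim quotation of a PUBLISHED theorem with page reference. The manuscript(s) under audit are NOT citable for their own disputed
steps — they are the thing under adjudication; programme-internal (2001/route/tribunal) claims are never citable.»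

WHY (an3-g56 (N-1) memo 7fa163ef7e91e99e §3 M10 «the input of EVERY n-free |·|-mass … of the `Ggh` legs in T4–T6»; owner ρ-g9-28 (f) «M10 IS THE LOCATED MISSING
LETTER OF ROW (N): NOT to be minted; … enters EXACTLY like `h12`: a displayed printed statement instantiated at our scalar family»).  Under the Ward-ray reading of
the ghost weights the first form's letter `|ωgh·x₀·cQ|·n² ≤ k` is out of reach of a bounded `x₀`; the form below needs only the block-distance-0 row mass
of `|Ggh|` and tolerates `|ωgh·x₀·cQ| ≤ k·n²`.

CONTENT (all [folklore]).
* §1 generic `abs_tadpole_le_sum_of_support` (finite-support tadpole, NO sup pulled out).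
* §2 `abs_qAntiAt_le_indicator` (`|qAntiAt … y x| ≤ n⁻⁴·(𝟙_N(x) + 𝟙_N(y))`), `sum_B_needleInd_le` (`≤ n^{κ+1}`), **`abs_tadpole_Ggh_qSqAt_le_of_rowMass`**
  (`≤ 2n⁻⁴·(n⁻⁴·(2·(M·n^{l+1})))`), **`abs_T₇_le_of_rowMass`** (`w ≠ 0`: `≤ 2·|x₀cQ|·M`), `abs_fullSum_T₇_le_of_rowMass`.
* §3 `pow_bookkeeping'`, **`h₇_of_rowMass (ha) (hM0) (hk : |ωgh n·(x₀ n·cQ n)| ≤ k·n²) ⊢ h₇` VERBATIM with `C₇ := 32·k·cM`**.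
Unit `b2b-balaban-beta-d1-formalise-leaf-04` (gen 8), D1 formalisation swarm; `LEAVES-BFx.md` row (N) ∕ «NT-7».
-/

noncomputable section

namespace Summit.QuantumFields.BalabanUV.Beta.D1BFx.NeedleGhostTadpoleRowMass

open Finset Filter Topology
open scoped BigOperators
open Literature.MathematicalPhysics.QuantumFieldTheory.Balaban1983to89
open Literature.MathematicalPhysics.QuantumFieldTheory.Balaban1983to89.Beta
open B6QGQLower276 (blk B mem_B chart sum_B)
open ExpKernelCalculus (Site MKer tadpole tr comp)
open Literature.Probability.LatticeModels (annulus)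
open DyadicShell (Pt toReal supNorm mem_annulus_iff supNorm_eq_zero_iff)
open WindowIdentification (psum fullSum)
open DressedMomentNormalisation (resSite)
open KernelReflection (tadpole_smul)
open Summit.QuantumFields.BalabanUV.Beta.D1BFx.DressedTablesLeg (tadpoleTableA tadpoleTableA_apply)
open Summit.QuantumFields.BalabanUV.Beta.D1BFx.ContactCount (abs_sum_mul_le_of_convex abs_fullSum_weighted_le_of_support)
open Summit.QuantumFields.BalabanUV.Beta.D1BFx.Assembly (sum_uniform_resSite uniform_resSite_nonneg)
open Summit.QuantumFields.BalabanUV.Beta.D1BFx.GhostLeg (Ggh side_pred Ggh_symm)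
open Summit.QuantumFields.BalabanUV.Beta.D1BFx.GhostStencilRooted (qJetAt qAntiAt qAntiAt_apply)
open Summit.QuantumFields.BalabanUV.Beta.D1BFx.GhostStencilRootedReflection (ctrHalf)
open Summit.QuantumFields.BalabanUV.Beta.D1BFx.GhostAveragingSquare (qSqAt qSqAt_apply WghAt)
open Summit.QuantumFields.BalabanUV.Beta.D1BFx.AveragingJetNeedle (card_needle_le)
open Summit.QuantumFields.BalabanUV.Beta.D1BFx.GhostNeedleRootedLetters (abs_qAntiAt_le qJetAt_le_indicator)
open Summit.QuantumFields.BalabanUV.Beta.D1BFx.NeedleGhostTadpoleRow (tadpole_eq_sum_of_support qSqAt_eq_zero_of_not_mem_left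
  qSqAt_eq_zero_of_not_mem_right WghAt_offDiag T₇_eq_zero_of_far)

/-! ## §1 Generic: the finite-support tadpole without the sup -/

section RowMassGeneric

variable {D : ℕ} {F : Type*} [Fintype F] {A V : MKer D F}

/-- [folklore] **A TADPOLE AGAINST A FINITELY SUPPORTED KERNEL, NO SUP PULLED OUT**: `|tadpole A V| ≤ Σ_{x ∈ S} Σ_a Σ_{y ∈ S} Σ_f |A x y a f|·|V y x f a|`
(the form in which a row∕column |·|-mass letter of the leg can be spent instead of its sup). -/
theorem abs_tadpole_le_sum_of_support (S : Finset (Site D)) (hl : ∀ y, y ∉ S → ∀ x f a, V y x f a = 0)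
    (hr : ∀ x, x ∉ S → ∀ y f a, V y x f a = 0) :
    |tadpole A V| ≤ ∑ x ∈ S, ∑ a, ∑ y ∈ S, ∑ f, |A x y a f| * |V y x f a| := by
  rw [tadpole_eq_sum_of_support S hl hr]
  calc |∑ x ∈ S, ∑ a, ∑ y ∈ S, ∑ f, A x y a f * V y x f a|
      ≤ ∑ x ∈ S, |∑ a, ∑ y ∈ S, ∑ f, A x y a f * V y x f a| := Finset.abs_sum_le_sum_abs _ _
    _ ≤ ∑ x ∈ S, ∑ a, |∑ y ∈ S, ∑ f, A x y a f * V y x f a| := Finset.sum_le_sum fun x _ => Finset.abs_sum_le_sum_abs _ _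
    _ ≤ ∑ x ∈ S, ∑ a, ∑ y ∈ S, |∑ f, A x y a f * V y x f a| :=
        Finset.sum_le_sum fun x _ => Finset.sum_le_sum fun a _ => Finset.abs_sum_le_sum_abs _ _
    _ ≤ ∑ x ∈ S, ∑ a, ∑ y ∈ S, ∑ f, |A x y a f * V y x f a| :=
        Finset.sum_le_sum fun x _ => Finset.sum_le_sum fun a _ => Finset.sum_le_sum fun y _ => Finset.abs_sum_le_sum_abs _ _
    _ = ∑ x ∈ S, ∑ a, ∑ y ∈ S, ∑ f, |A x y a f| * |V y x f a| := by simp only [abs_mul]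

end RowMassGeneric

/-! ## §2 The averaging square and the completed ghost tadpole word under the leg's block-row |·|-mass -/

section RowMass

variable (ρ : Site 4) (n : ℕ) [NeZero n] (κ : Fin 4) (u : Site 4) (l : Fin 4) (u' : Site 4)

/-- [folklore] **NEEDLE INDICATOR FOR THE STRIPPED JET**: `|qAntiAt ρ n κ u y x| ≤ n⁻⁴·(𝟙[x_j = u_j ∀ j > κ] + 𝟙[y_j = u_j ∀ j > κ])` (two rooted jets, each
dominated by `n⁻⁴` times the needle indicator of its fine argument — `GhostNeedleRootedLetters.qJetAt_le_indicator`, every root). -/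
theorem abs_qAntiAt_le_indicator (y x : Site 4) (a b : Unit) :
    |qAntiAt ρ n κ u y x a b| ≤ ((n : ℝ) ^ 4)⁻¹ *
      ((if ∀ j : Fin 4, (κ : ℕ) < j → x j = u j then (1 : ℝ) else 0) + (if ∀ j : Fin 4, (κ : ℕ) < j → y j = u j then (1 : ℝ) else 0)) := by
  rw [qAntiAt_apply]
  have h1 := qJetAt_le_indicator ρ n κ u (blk (n - 1) y) x
  have h2 := qJetAt_le_indicator ρ n κ u (blk (n - 1) x) y
  calc |qJetAt ρ n κ u (blk (n - 1) y) x - qJetAt ρ n κ u (blk (n - 1) x) y|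
      ≤ |qJetAt ρ n κ u (blk (n - 1) y) x| + |qJetAt ρ n κ u (blk (n - 1) x) y| := abs_sub _ _
    _ ≤ _ := by rw [mul_add]; exact add_le_add h1 h2

/-- [folklore] **THE NEEDLE COUNT ON A BLOCK**: `Σ_{x ∈ B(y)} 𝟙[x_j = u_j ∀ j > κ] ≤ n^{κ+1}` (`AveragingJetNeedle.card_needle_le` through the cube chart). -/
theorem sum_B_needleInd_le (y : Site 4) :
    ∑ x ∈ B (n - 1) y, (if ∀ j : Fin 4, (κ : ℕ) < j → x j = u j then (1 : ℝ) else 0) ≤ (n : ℝ) ^ ((κ : ℕ) + 1) := by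
  set c : Fin 4 → ℤ := fun j => u j - (n : ℤ) * y j with hc
  have hchart : ∀ (z : Fin 4 → Fin (n - 1 + 1)) (j : Fin 4), chart (n - 1) y z j = u j ↔ ((z j : ℕ) : ℤ) = c j := by
    intro z j
    simp only [chart, side_pred, hc]
    constructor <;> intro h <;> linarith
  calc ∑ x ∈ B (n - 1) y, (if ∀ j : Fin 4, (κ : ℕ) < j → x j = u j then (1 : ℝ) else 0)
      = ∑ z : Fin 4 → Fin (n - 1 + 1), (if ∀ j : Fin 4, (κ : ℕ) < j → ((z j : ℕ) : ℤ) = c j then (1 : ℝ) else 0) := by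
        rw [sum_B]
        refine Finset.sum_congr rfl fun z _ => ?_
        have : (∀ j : Fin 4, (κ : ℕ) < j → chart (n - 1) y z j = u j) ↔ (∀ j : Fin 4, (κ : ℕ) < j → ((z j : ℕ) : ℤ) = c j) :=
          forall_congr' fun j => imp_congr_right fun _ => hchart z j
        simp only [this]
    _ = ((Finset.univ.filter fun z : Fin 4 → Fin (n - 1 + 1) => ∀ j : Fin 4, (κ : ℕ) < j → ((z j : ℕ) : ℤ) = c j).card : ℝ) := by
        rw [Finset.sum_boole]
    _ ≤ (n : ℝ) ^ ((κ : ℕ) + 1) := card_needle_le n κ c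

variable {a : ℝ}

/-- [folklore] **THE GHOST TADPOLE OF THE AVERAGING SQUARE UNDER THE LEG's BLOCK-ROW |·|-MASS** (displayed `hM`: every row of `|Ggh|` summed over the block of
the bonds is `≤ M`; columns by `GhostLeg.Ggh_symm`): `|tadpole (Ggh n a) (qSqAt ρ n κ u l u′)| ≤ 2n⁻⁴·(n⁻⁴·(2·(M·n^{l+1})))` — the first stripped
jet by its sharp sup,
the second by its needle indicator; each indicator meets ONE leg mass `M` and the needle count `n^{l+1}`. -/
theorem abs_tadpole_Ggh_qSqAt_le_of_rowMass (ha : 0 < a) {M : ℝ}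
    (hM : ∀ x : Site 4, ∑ z ∈ B (n - 1) (blk (n - 1) u'), |Ggh n a x z () ()| ≤ M) :
    |tadpole (Ggh n a) (qSqAt ρ n κ u l u')| ≤
      2 * ((n : ℝ) ^ 4)⁻¹ * (((n : ℝ) ^ 4)⁻¹ * (2 * (M * (n : ℝ) ^ ((l : ℕ) + 1)))) := by
  have hn : (0 : ℝ) < n := by exact_mod_cast Nat.pos_of_ne_zero (NeZero.ne n)
  set S := B (n - 1) (blk (n - 1) u') with hS
  set I : Site 4 → ℝ := fun z => if ∀ j : Fin 4, (l : ℕ) < j → z j = u' j then (1 : ℝ) else 0 with hI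
  have hI0 : ∀ z, 0 ≤ I z := fun z => by simp only [hI]; split_ifs <;> norm_num
  have hM0 : 0 ≤ M := (Finset.sum_nonneg fun z _ => abs_nonneg _).trans (hM 0)
  set c : ℝ := 2 * ((n : ℝ) ^ 4)⁻¹ * ((n : ℝ) ^ 4)⁻¹ with hc
  have hc0 : 0 ≤ c := by positivity
  -- termwise: `|G x y|·|qSqAt y x| ≤ c·(|G x y|·I x) + c·(|G x y|·I y)`
  have hterm : ∀ x y : Site 4, |Ggh n a x y () ()| * |qSqAt ρ n κ u l u' y x () ()| ≤
      c * (|Ggh n a x y () ()| * I x) + c * (|Ggh n a x y () ()| * I y) := by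
    intro x y
    have h1 := abs_qAntiAt_le ρ n κ u y x () ()
    have h2 := abs_qAntiAt_le_indicator ρ n l u' y x () ()
    have hG := abs_nonneg (Ggh n a x y () ())
    rw [qSqAt_apply, abs_mul]
    have hprod : |qAntiAt ρ n κ u y x () ()| * |qAntiAt ρ n l u' y x () ()| ≤
        (2 * ((n : ℝ) ^ 4)⁻¹) * (((n : ℝ) ^ 4)⁻¹ * (I x + I y)) :=
      mul_le_mul h1 h2 (abs_nonneg _) (by positivity)
    calc |Ggh n a x y () ()| * (|qAntiAt ρ n κ u y x () ()| * |qAntiAt ρ n l u' y x () ()|)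
        ≤ |Ggh n a x y () ()| * ((2 * ((n : ℝ) ^ 4)⁻¹) * (((n : ℝ) ^ 4)⁻¹ * (I x + I y))) := mul_le_mul_of_nonneg_left hprod hG
      _ = c * (|Ggh n a x y () ()| * I x) + c * (|Ggh n a x y () ()| * I y) := by simp only [hc]; ring
  -- the two indicator sums against the leg masses
  have hrow : ∀ x, ∑ y ∈ S, |Ggh n a x y () ()| ≤ M := fun x => hM x
  have hcol : ∀ y, ∑ x ∈ S, |Ggh n a x y () ()| ≤ M := by
    intro y
    have e : ∑ x ∈ S, |Ggh n a x y () ()| = ∑ x ∈ S, |Ggh n a y x () ()| :=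
      Finset.sum_congr rfl fun x _ => by rw [Ggh_symm n a ha x y () ()]
    rw [e]; exact hM y
  have hInd : ∑ z ∈ S, I z ≤ (n : ℝ) ^ ((l : ℕ) + 1) := sum_B_needleInd_le n l u' (blk (n - 1) u')
  have hA : ∑ x ∈ S, ∑ y ∈ S, c * (|Ggh n a x y () ()| * I x) ≤ c * (M * (n : ℝ) ^ ((l : ℕ) + 1)) := by
    calc ∑ x ∈ S, ∑ y ∈ S, c * (|Ggh n a x y () ()| * I x)
        = ∑ x ∈ S, (c * I x) * ∑ y ∈ S, |Ggh n a x y () ()| := by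
          refine Finset.sum_congr rfl fun x _ => ?_
          rw [Finset.mul_sum]
          exact Finset.sum_congr rfl fun y _ => by ring
      _ ≤ ∑ x ∈ S, (c * I x) * M := Finset.sum_le_sum fun x _ => mul_le_mul_of_nonneg_left (hrow x) (mul_nonneg hc0 (hI0 x))
      _ = c * M * ∑ x ∈ S, I x := by rw [Finset.mul_sum]; exact Finset.sum_congr rfl fun x _ => by ring
      _ ≤ c * M * (n : ℝ) ^ ((l : ℕ) + 1) := mul_le_mul_of_nonneg_left hInd (mul_nonneg hc0 hM0)
      _ = c * (M * (n : ℝ) ^ ((l : ℕ) + 1)) := by ring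
  have hB : ∑ x ∈ S, ∑ y ∈ S, c * (|Ggh n a x y () ()| * I y) ≤ c * (M * (n : ℝ) ^ ((l : ℕ) + 1)) := by
    rw [Finset.sum_comm]
    calc ∑ y ∈ S, ∑ x ∈ S, c * (|Ggh n a x y () ()| * I y)
        = ∑ y ∈ S, (c * I y) * ∑ x ∈ S, |Ggh n a x y () ()| := by
          refine Finset.sum_congr rfl fun y _ => ?_
          rw [Finset.mul_sum]
          exact Finset.sum_congr rfl fun x _ => by ring
      _ ≤ ∑ y ∈ S, (c * I y) * M := Finset.sum_le_sum fun y _ => mul_le_mul_of_nonneg_left (hcol y) (mul_nonneg hc0 (hI0 y))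
      _ = c * M * ∑ y ∈ S, I y := by rw [Finset.mul_sum]; exact Finset.sum_congr rfl fun y _ => by ring
      _ ≤ c * M * (n : ℝ) ^ ((l : ℕ) + 1) := mul_le_mul_of_nonneg_left hInd (mul_nonneg hc0 hM0)
      _ = c * (M * (n : ℝ) ^ ((l : ℕ) + 1)) := by ring
  refine (abs_tadpole_le_sum_of_support (B (n - 1) (blk (n - 1) u'))
    (fun y hy x f a' => qSqAt_eq_zero_of_not_mem_left ρ n κ u l u' y hy x f a')
    (fun x hx y f a' => qSqAt_eq_zero_of_not_mem_right ρ n κ u l u' x hx y f a')).trans ?_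
  calc ∑ x ∈ B (n - 1) (blk (n - 1) u'), ∑ a' : Unit, ∑ y ∈ B (n - 1) (blk (n - 1) u'), ∑ f' : Unit,
        |Ggh n a x y a' f'| * |qSqAt ρ n κ u l u' y x f' a'|
      = ∑ x ∈ S, ∑ y ∈ S, |Ggh n a x y () ()| * |qSqAt ρ n κ u l u' y x () ()| := by
        simp only [Fintype.sum_unique, PUnit.default_eq_unit]
        rfl
    _ ≤ ∑ x ∈ S, ∑ y ∈ S, (c * (|Ggh n a x y () ()| * I x) + c * (|Ggh n a x y () ()| * I y)) :=
        Finset.sum_le_sum fun x _ => Finset.sum_le_sum fun y _ => hterm x y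
    _ = (∑ x ∈ S, ∑ y ∈ S, c * (|Ggh n a x y () ()| * I x)) + ∑ x ∈ S, ∑ y ∈ S, c * (|Ggh n a x y () ()| * I y) := by
        rw [← Finset.sum_add_distrib]
        exact Finset.sum_congr rfl fun x _ => Finset.sum_add_distrib
    _ ≤ c * (M * (n : ℝ) ^ ((l : ℕ) + 1)) + c * (M * (n : ℝ) ^ ((l : ℕ) + 1)) := add_le_add hA hB
    _ = 2 * ((n : ℝ) ^ 4)⁻¹ * (((n : ℝ) ^ 4)⁻¹ * (2 * (M * (n : ℝ) ^ ((l : ℕ) + 1)))) := by simp only [hc]; ring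

variable (x₀ cK cQ : ℝ)

/-- [folklore] **THE COMPLETED GHOST TADPOLE WORD UNDER THE LEG's BLOCK-ROW |·|-MASS**: for `w ≠ 0`,
`|tadpoleTableA (Ggh n a) (WghAt ρ n x₀ cK cQ) μ ν (b + w) b| ≤ 2·|x₀·cQ|·M` — weight `x₀cQn⁴` × first jet `2n⁻⁴` × second jet `n⁻⁴` ×
`(needle count n^{ν+1} ≤ n⁴) × (leg mass M)`, twice. -/
theorem abs_T₇_le_of_rowMass (ha : 0 < a) (μ ν : Fin 4) (b : Pt) {w : Pt} (hw : w ≠ 0) {M : ℝ}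
    (hM : ∀ x : Site 4, ∑ z ∈ B (n - 1) (blk (n - 1) b), |Ggh n a x z () ()| ≤ M) :
    |tadpoleTableA (Ggh n a) (WghAt ρ n x₀ cK cQ) μ ν (b + w) b| ≤ 2 * |x₀ * cQ| * M := by
  have hn1 : (1 : ℝ) ≤ n := by exact_mod_cast NeZero.one_le
  have hn : (0 : ℝ) < n := by linarith
  have hM0 : 0 ≤ M := (Finset.sum_nonneg fun z _ => abs_nonneg _).trans (hM 0)
  have hbw : b + w ≠ b := fun e => hw (by simpa using e)
  rw [tadpoleTableA_apply, WghAt_offDiag ρ n x₀ cK cQ μ ν hbw, tadpole_smul, abs_mul, abs_mul,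
    abs_of_pos (by norm_num : (0 : ℝ) < 1 / 2)]
  have hT := abs_tadpole_Ggh_qSqAt_le_of_rowMass ρ n μ (b + w) ν b ha hM
  have hν : (n : ℝ) ^ ((ν : ℕ) + 1) * ((n : ℝ) ^ 4)⁻¹ ≤ 1 := by
    rw [← div_eq_mul_inv, div_le_one (pow_pos hn 4)]
    exact pow_le_pow_right₀ hn1 (by have := ν.isLt; omega)
  have hT' : |tadpole (Ggh n a) (qSqAt ρ n μ (b + w) ν b)| ≤ 2 * ((n : ℝ) ^ 4)⁻¹ * (2 * M) := by
    refine hT.trans ?_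
    have e : 2 * ((n : ℝ) ^ 4)⁻¹ * (((n : ℝ) ^ 4)⁻¹ * (2 * (M * (n : ℝ) ^ ((ν : ℕ) + 1)))) =
        2 * ((n : ℝ) ^ 4)⁻¹ * (2 * M) * ((n : ℝ) ^ ((ν : ℕ) + 1) * ((n : ℝ) ^ 4)⁻¹) := by ring
    rw [e]
    exact mul_le_of_le_one_right (by positivity) hν
  have hc : |(-(x₀ * cQ * (n : ℝ) ^ 4))| = |x₀ * cQ| * (n : ℝ) ^ 4 := by
    rw [abs_neg, abs_mul, abs_of_pos (pow_pos hn 4)]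
  rw [hc]
  calc 1 / 2 * (|x₀ * cQ| * (n : ℝ) ^ 4 * |tadpole (Ggh n a) (qSqAt ρ n μ (b + w) ν b)|)
      ≤ 1 / 2 * (|x₀ * cQ| * (n : ℝ) ^ 4 * (2 * ((n : ℝ) ^ 4)⁻¹ * (2 * M))) :=
        mul_le_mul_of_nonneg_left (mul_le_mul_of_nonneg_left hT' (by positivity)) (by norm_num)
    _ = 2 * |x₀ * cQ| * M := by field_simp

/-- [folklore] The weighted full sum at a base site under the leg's block-row |·|-mass: `≤ (2(n−1)+1)⁴·((n−1)²·(2·|x₀cQ|·M))`. -/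
theorem abs_fullSum_T₇_le_of_rowMass (ha : 0 < a) (μ ν : Fin 4) (b : Pt) {M : ℝ}
    (hM : ∀ x : Site 4, ∑ z ∈ B (n - 1) (blk (n - 1) b), |Ggh n a x z () ()| ≤ M) :
    |fullSum (fun w : Pt => toReal w μ * toReal w ν * tadpoleTableA (Ggh n a) (WghAt ρ n x₀ cK cQ) μ ν (b + w) b)| ≤
      (2 * ((n - 1 : ℕ) : ℝ) + 1) ^ 4 * ((((n - 1 : ℕ) : ℝ)) ^ 2 * (2 * |x₀ * cQ| * M)) := by
  have hM0 : 0 ≤ M := (Finset.sum_nonneg fun z _ => abs_nonneg _).trans (hM 0)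
  refine abs_fullSum_weighted_le_of_support (by positivity) (fun w hw => T₇_eq_zero_of_far ρ n x₀ cK cQ μ ν b w hw) (fun w hw => ?_) μ ν
  have hw0 : w ≠ 0 := fun e => by
    have h1 := (mem_annulus_iff.mp hw).1
    rw [e, supNorm_eq_zero_iff.mpr rfl] at h1
    exact lt_irrefl _ h1
  exact abs_T₇_le_of_rowMass ρ n x₀ cK cQ ha μ ν b hw0 hM

end RowMass

/-! ## §3 In the glue's currency: `h₇` under `hM0` and the scaling letter -/

section GlueRowMass

variable {a : ℝ} {x₀ cK cQ ωgh : ℕ → ℝ} {k cM : ℝ}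

/-- [folklore] Arithmetic of the block-size powers, second form: `n⁻⁸·(2(n−1)+1)⁴·(n−1)² ≤ 16·(n²)⁻¹` (`n ≥ 1`). -/
theorem pow_bookkeeping' (n : ℕ) (hn : 1 ≤ n) :
    ((n : ℝ) ^ 8)⁻¹ * ((2 * ((n - 1 : ℕ) : ℝ) + 1) ^ 4 * (((n - 1 : ℕ) : ℝ)) ^ 2) ≤ 16 * ((n : ℝ) ^ 2)⁻¹ := by
  have hn' : (1 : ℝ) ≤ n := by exact_mod_cast hn
  have hpos : (0 : ℝ) < n := by linarith
  have e : ((n - 1 : ℕ) : ℝ) = (n : ℝ) - 1 := by rw [Nat.cast_sub hn, Nat.cast_one]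
  rw [e]
  have h1 : (2 * ((n : ℝ) - 1) + 1) ^ 4 ≤ (2 * (n : ℝ)) ^ 4 :=
    pow_le_pow_left₀ (by linarith) (by linarith) 4
  have h2 : ((n : ℝ) - 1) ^ 2 ≤ (n : ℝ) ^ 2 := pow_le_pow_left₀ (by linarith) (by linarith) 2
  calc ((n : ℝ) ^ 8)⁻¹ * ((2 * ((n : ℝ) - 1) + 1) ^ 4 * ((n : ℝ) - 1) ^ 2)
      ≤ ((n : ℝ) ^ 8)⁻¹ * ((2 * (n : ℝ)) ^ 4 * (n : ℝ) ^ 2) := by gcongr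
    _ = 16 * ((n : ℝ) ^ 2)⁻¹ := by field_simp; ring

/-- [folklore] **«NT-7» UNDER THE LEG's BLOCK-ROW |·|-MASS LETTER (v1.1)** — displayed: `0 < a`; the distance-0 block-row |·|-mass letter of the ghost leg
`hM0 : ∀ n ≥ 2, ∀ x Y, Σ_{z ∈ B(Y)} |Ggh n a x z| ≤ cM` with `cM` FREE OF n (an3-g56's M10 at block distance 0 — a located, NOT minted letter: a hypothesis
here, to be instantiated from print like the END's `h12`); and ONE scaling letter `|ωgh n · (x₀ n · cQ n)| ≤ k · n²`.  Output = `h₇` of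
`NeedleRowGlue.abs_gN_row_le_of_tables` VERBATIM with `C₇ := 32·k·cM` — TOLERANCE `n²` (v1's count × sup: `n⁻²`). -/
theorem h₇_of_rowMass (ha : 0 < a)
    (hM0 : ∀ n : ℕ, 2 ≤ n → ∀ [NeZero n], ∀ x Y : Site 4, ∑ z ∈ B (n - 1) Y, |Ggh n a x z () ()| ≤ cM)
    (hk : ∀ n : ℕ, 2 ≤ n → |ωgh n * (x₀ n * cQ n)| ≤ k * (n : ℝ) ^ 2) (μ ν : Fin 4) :
    ∀ n : ℕ, 2 ≤ n → ∀ [NeZero n], |ωgh n * ∑ b ∈ (univ : Finset (Fin 4 → Fin n)).image resSite, ((n : ℝ) ^ 4)⁻¹ * (((n : ℝ) ^ 8)⁻¹ *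
      fullSum (fun w : Pt => toReal w μ * toReal w ν *
        tadpoleTableA (Ggh n a) (WghAt (ctrHalf n) n (x₀ n) (cK n) (cQ n)) μ ν (b + w) b))| ≤ 32 * k * cM := by
  intro n hn _
  have h1 : 1 ≤ n := le_trans (by norm_num) hn
  have hn0 : (0 : ℝ) < n := by exact_mod_cast (show 0 < n by omega)
  have hcM : 0 ≤ cM := (Finset.sum_nonneg fun z _ => abs_nonneg _).trans (hM0 n hn 0 0)
  have hk0 : 0 ≤ k := by
    have := (abs_nonneg _).trans (hk n hn)
    nlinarith [pow_pos hn0 2]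
  -- base-point average of the pointwise full-sum bound
  have hrow : |ωgh n * ∑ b ∈ (univ : Finset (Fin 4 → Fin n)).image resSite, ((n : ℝ) ^ 4)⁻¹ * (((n : ℝ) ^ 8)⁻¹ *
      fullSum (fun w : Pt => toReal w μ * toReal w ν *
        tadpoleTableA (Ggh n a) (WghAt (ctrHalf n) n (x₀ n) (cK n) (cQ n)) μ ν (b + w) b))| ≤
      |ωgh n| * (((n : ℝ) ^ 8)⁻¹ * ((2 * ((n - 1 : ℕ) : ℝ) + 1) ^ 4 * ((((n - 1 : ℕ) : ℝ)) ^ 2 * (2 * |x₀ n * cQ n| * cM)))) := by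
    rw [abs_mul]
    refine mul_le_mul_of_nonneg_left ?_ (abs_nonneg _)
    refine abs_sum_mul_le_of_convex _ (fun b hb => uniform_resSite_nonneg n b hb) (sum_uniform_resSite (NeZero.ne n)) fun b _ => ?_
    rw [abs_mul, abs_of_nonneg (by positivity : (0 : ℝ) ≤ ((n : ℝ) ^ 8)⁻¹)]
    exact mul_le_mul_of_nonneg_left
      (abs_fullSum_T₇_le_of_rowMass (ctrHalf n) n (x₀ n) (cK n) (cQ n) ha μ ν b (fun x => hM0 n hn x (blk (n - 1) b))) (by positivity)
  refine hrow.trans ?_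
  have hpb := pow_bookkeeping' n h1
  have e : |ωgh n| * (((n : ℝ) ^ 8)⁻¹ * ((2 * ((n - 1 : ℕ) : ℝ) + 1) ^ 4 * ((((n - 1 : ℕ) : ℝ)) ^ 2 * (2 * |x₀ n * cQ n| * cM)))) =
      |ωgh n * (x₀ n * cQ n)| * (((n : ℝ) ^ 8)⁻¹ * ((2 * ((n - 1 : ℕ) : ℝ) + 1) ^ 4 * (((n - 1 : ℕ) : ℝ)) ^ 2)) * (2 * cM) := by
    rw [abs_mul (ωgh n)]
    ring
  rw [e]
  calc |ωgh n * (x₀ n * cQ n)| * (((n : ℝ) ^ 8)⁻¹ * ((2 * ((n - 1 : ℕ) : ℝ) + 1) ^ 4 * (((n - 1 : ℕ) : ℝ)) ^ 2)) * (2 * cM)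
      ≤ (k * (n : ℝ) ^ 2) * (16 * ((n : ℝ) ^ 2)⁻¹) * (2 * cM) := by
        gcongr
        · exact hk n hn
    _ = 32 * k * cM := by field_simp; ring

end GlueRowMass

end Summit.QuantumFields.BalabanUV.Beta.D1BFx.NeedleGhostTadpoleRowMass

end
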